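import Mathlib
import HarnessLib
import Literature.Analysis.FluidPDE.SuitableWeak
import Literature.Analysis.FluidPDE.ClassicalSolution
import Literature.Analysis.FluidPDE.LerayHopf
import Literature.Analysis.FluidPDE.SelfSimilar
import Literature.Analysis.FluidPDE.LocalTypeI
import Literature.Analysis.FluidPDE.AxisymmetricEuler
import Summits.NavierStokesRegularity.NavierStokesRegularity.Theorems.ZoomReturnDoorDefs

/-!
# StableStrataDoorOneSliceDefs — SEED-26 «the SEQUENTIAL ε-door» of door S26 «StableStrataDoor»: the texts of the
three typed INPUTS and of Seregin's `L³`-floor (nsreg-p1 g21, ADDENDUM-25A; texts VERBATIM from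
`run/shared/lean/pub/ns-regularity-ideate/ns-regularity-ideate-p1/r25/seed26/Sketch26A.lean` §0 (`HasL3Floor`) and §1)

S26 (`StableStrataDoor*`, ROUND-25) proves the ε-door of an analytic stratum from EVENTUAL smallness of a window
observable (`∀ᶠ t → T⁻`).  The sharper SEQUENTIAL door («smallness along ONE sequence `tₙ → T⁻` is already impossible at
a Type-I singular point») needs a nontriviality certificate that survives two limits: Seregin's scale-invariant
`L³`-FLOOR at the apex, `c·r² ≤ ∫_{Q(r)} |v|³` for EVERY `r > 0` (Seregin 2014, Prop. 6.20 (6.6.1), applied at every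
scale).  This file only TYPES:

* `HasL3Floor c v` — the floor;
* **I1** `LocalPointZoomAlongTimes` — the local point zoom along PRESCRIBED times whose limit carries the floor;
* **I2a** `FloorSurvives D c` — PURE ANALYSIS: jointly continuous fields with the uniform decay `D/(|x|+√−t)` and the
  floor `c` cannot converge pointwise to `0` on `t < −1/4` (PROVED in `StableStrataDoorFloorSurvives`);
* **I2b** `OneSliceAxiPropagation A D` — axisymmetry of ONE slice of a classical Type-I ancient solution propagates to
  every slice.

Door family of LADDER-NS N0 (door S26 / SEED-26, `--supports stmt-NavierStokesRegularity-0056`, helper lane; nsreg-p6 g14).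
WHAT THIS IS NOT: not NS regularity (Clay A); no route, no item; the doors these inputs feed are criteria INSIDE the
Type-I class.
-/

noncomputable section

set_option linter.dupNamespace false

namespace Summit.NavierStokesRegularity.NavierStokesRegularity.Theorems.StableStrataDoorOneSliceDefs

open MeasureTheory Set Function Filter Topology TopologicalSpace Metric
open scoped RealInnerProductSpace NNReal ENNReal Topology
open Literature.Analysis Literature.Analysis.FluidPDE
open Summit.NavierStokesRegularity.NavierStokesRegularity.Theorems.ZoomReturnDoorDefs

/-- **The scale-invariant `L³`-FLOOR at the apex** with constant `c`: `c·r² ≤ ∫_{Q(r)} |v|³` for EVERY `r > 0`,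
`Q(r) = (−r², 0) × B_r(0)` the backward parabolic cylinder (Seregin 2014, Prop. 6.20 (6.6.1), at all scales).  Closed under
pointwise limits with uniform Type-I decay (dominated convergence); violated by the zero profile. -/
def HasL3Floor (c : ℝ) (v : ℝ → EuclideanSpace ℝ (Fin 3) → EuclideanSpace ℝ (Fin 3)) : Prop :=
  ∀ r : ℝ, 0 < r → ENNReal.ofReal (c * r ^ 2) ≤
    ∫⁻ z in parabolicCylinder r (0 : ℝ × EuclideanSpace ℝ (Fin 3)), ENNReal.ofReal (‖uncurry v z‖ ^ 3)

/-- **I1 · THE LOCAL POINT ZOOM ALONG PRESCRIBED TIMES.**  For every viscosity a floor constant `c(ν) > 0` such that: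
physical prefix of the S23–S26 doors (classical Leray–Hopf solution on `[0,T)`, space–time local Type I with constant `M`
at `(x₀,T)`) + backward unboundedness at `(x₀,T)` + ANY sequence of times `tₙ → T⁻` ⇒ along a subsequence, the parabolic
zooms at the scales `λ² = ν (T − tₙ)` (so that physical time `tₙ` is profile time `−1`) converge pointwise at every profile
time to ONE door-class profile carrying the `L³`-FLOOR `c` at the apex.  (The tree's `localPointZoomVelSlices` chooses its
own scales; prescribed scales + floor = ESS 2003 §5 / Seregin 2014 Prop. 6.20 (6.6.1), applied at every scale.) -/
def LocalPointZoomAlongTimes : Prop :=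
  ∀ (ν : ℝ), 0 < ν → ∃ c : ℝ, 0 < c ∧ ∀ (T : ℝ), 0 < T → ∀ (u : ℝ → EuclideanSpace ℝ (Fin 3) → EuclideanSpace ℝ (Fin 3))
    (p : ℝ → EuclideanSpace ℝ (Fin 3) → ℝ), IsClassicalNSSolutionOn (Set.Ico 0 T) ν 0 u p →
    IsLerayHopfOn T ν 0 (u 0) u → HasRapidSpatialDecay (u 0) →
    ∀ (x₀ : EuclideanSpace ℝ (Fin 3)) (ρ M : ℝ), 0 < ρ →
    (∀ t ∈ Set.Ico 0 T, T - ρ ^ 2 < t → ∀ x ∈ Metric.ball x₀ ρ, ‖u t x‖ * (‖x - x₀‖ + Real.sqrt (ν * (T - t))) ≤ M) →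
    ¬ IsBackwardBoundedAt u T x₀ →
    ∀ (t : ℕ → ℝ), (∀ n, t n < T) → Tendsto t atTop (𝓝 T) →
    ∃ (φ : ℕ → ℕ) (C : ℝ) (v : ℝ → EuclideanSpace ℝ (Fin 3) → EuclideanSpace ℝ (Fin 3)) (lam : ℕ → ℝ),
      StrictMono φ ∧ (∀ j, 0 < lam j) ∧ (∀ j, lam j ^ 2 = ν * (T - t (φ j))) ∧ IsDoorProfile C v ∧ HasL3Floor c v ∧
      ∀ s < 0, ∀ y, Tendsto (fun j => (lam j / ν) • u (T + lam j ^ 2 * s / ν) (x₀ + lam j • y)) atTop (𝓝 (v s y))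

/-- **I2a · THE FLOOR SURVIVES (pure analysis).**  A sequence of jointly continuous fields on `(−∞,0) × ℝ³` with the uniform
decay `|uₙ| ≤ D/(|x| + √−t)` and the `L³`-floor `c` at the apex cannot converge pointwise to zero on `t < −1/4`: the floor at a
large radius `R` puts mass `≥ cR² − O(R)` in `(−R², −1/4) × B_R`, where bounded convergence applies. -/
def FloorSurvives (D c : ℝ) : Prop :=
  ∀ (u : ℕ → ℝ → EuclideanSpace ℝ (Fin 3) → EuclideanSpace ℝ (Fin 3)),
    (∀ n, ContinuousOn (uncurry (u n)) (Set.Iio (0 : ℝ) ×ˢ Set.univ)) → (∀ n, HasTypeIDecay D (u n)) →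
    (∀ n, HasL3Floor c (u n)) → ¬ (∀ s < -(1 / 4 : ℝ), ∀ y, Tendsto (fun n => u n s y) atTop (𝓝 0))

/-- **I2b · ONE-SLICE PROPAGATION OF AXISYMMETRY** (axis `A e₃`, decay `D`): a classical Type-I(`D`) solution on
`(−∞,0) × ℝ³` that is axisymmetric about `A e₃` at ONE time is axisymmetric about `A e₃` at every time (forward by
bounded-mild uniqueness applied to `V` and its rotation conjugates, backward by time analyticity — Dong–Zhang 2020). -/
def OneSliceAxiPropagation (A : EuclideanSpace ℝ (Fin 3) ≃ₗᵢ[ℝ] EuclideanSpace ℝ (Fin 3)) (D : ℝ) : Prop :=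
  ∀ (V : ℝ → EuclideanSpace ℝ (Fin 3) → EuclideanSpace ℝ (Fin 3)) (q : ℝ → EuclideanSpace ℝ (Fin 3) → ℝ),
    IsClassicalNSSolutionOn (Set.Iio 0) 1 0 V q → HasTypeIDecay D V →
    ∀ s₀ < 0, IsAxisymmetric (fun x => A.symm (V s₀ (A x))) → ∀ τ < 0, IsAxisymmetric (fun x => A.symm (V τ (A x)))

/-! ## ADDENDUM-25A v5 (nsreg-p1 g21, 2026-08-28T00:16Z; DIRECTOR-NS #82 (4)): I1 RE-TYPED with the floor constant AFTER the
Type-I bound `M` (`∀ ν, 0 < ν → ∀ M, ∃ c, …`), and its modular split I1a + I1b.  Texts VERBATIM from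
`r25/seed26/Sketch26A.lean` (bb69eb44dfa09fc3) §1; the v5 text of I1 is landed under the NEW name `LocalPointZoomAlongTimesM` (the
v3 text `LocalPointZoomAlongTimes` above, with `∃ c` before `M`, stays in tree unconsumed — it asks for a floor uniform in `M`, which
no tool in tree or print delivers: Seregin's floor is `κ(L)`, `Seregin2020CubicLowerBound.exists_le_cknC_of_isBackwardSingularPoint`). -/

/-- **I1 (v5) · THE LOCAL POINT ZOOM ALONG PRESCRIBED TIMES, floor constant `c = c(ν, M)`.**  For every viscosity `ν` and every
local Type-I bound `M` a floor constant `c > 0` such that: physical prefix of the S23–S26 doors (classical Leray–Hopf solution on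
`[0,T)`, space–time local Type I with constant `M` at `(x₀,T)`) + backward unboundedness at `(x₀,T)` + ANY sequence of times
`tₙ → T⁻` ⇒ along a subsequence, the parabolic zooms at the scales `λ² = ν (T − tₙ)` (physical time `tₙ` = profile time `−1`)
converge pointwise at every profile time to ONE door-class profile carrying the `L³`-FLOOR `c` at the apex.  This is the form the
assembly `seqDoorAt_of` needs (it fixes `ν, M` first) and the form the split I1a + I1b delivers.  (Body = v5 `LocalPointZoomAlongTimes`
VERBATIM; renamed because the v3 name is taken above.) -/
def LocalPointZoomAlongTimesM : Prop :=
  ∀ (ν : ℝ), 0 < ν → ∀ (M : ℝ), ∃ c : ℝ, 0 < c ∧ ∀ (T : ℝ), 0 < T → ∀ (u : ℝ → EuclideanSpace ℝ (Fin 3) → EuclideanSpace ℝ (Fin 3))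
    (p : ℝ → EuclideanSpace ℝ (Fin 3) → ℝ), IsClassicalNSSolutionOn (Set.Ico 0 T) ν 0 u p →
    IsLerayHopfOn T ν 0 (u 0) u → HasRapidSpatialDecay (u 0) →
    ∀ (x₀ : EuclideanSpace ℝ (Fin 3)) (ρ : ℝ), 0 < ρ →
    (∀ t ∈ Set.Ico 0 T, T - ρ ^ 2 < t → ∀ x ∈ Metric.ball x₀ ρ, ‖u t x‖ * (‖x - x₀‖ + Real.sqrt (ν * (T - t))) ≤ M) →
    ¬ IsBackwardBoundedAt u T x₀ →
    ∀ (t : ℕ → ℝ), (∀ n, t n < T) → Tendsto t atTop (𝓝 T) →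
    ∃ (φ : ℕ → ℕ) (C : ℝ) (v : ℝ → EuclideanSpace ℝ (Fin 3) → EuclideanSpace ℝ (Fin 3)) (lam : ℕ → ℝ),
      StrictMono φ ∧ (∀ j, 0 < lam j) ∧ (∀ j, lam j ^ 2 = ν * (T - t (φ j))) ∧ IsDoorProfile C v ∧ HasL3Floor c v ∧
      ∀ s < 0, ∀ y, Tendsto (fun j => (lam j / ν) • u (T + lam j ^ 2 * s / ν) (x₀ + lam j • y)) atTop (𝓝 (v s y))

/-- **I1a · THE LOCAL POINT ZOOM ALONG PRESCRIBED TIMES, singular-apex form (no floor).**  As I1, but the limit is only asserted to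
be a door-class profile that is BACKWARD-SINGULAR at the apex `(0,0)` — the export of the tree's `localPointZoomVelSlices`, with the one
change that the scales are PRESCRIBED, `λⱼ² = ν (T − t_{φ j})` (singularity of the limit along prescribed scales: persistence of
singularities, Albritton–Barker 2019 Prop. 2.3, fed by the scale-invariant bounds of the space–time Type-I prefix). -/
def LocalPointZoomAlongTimesSing : Prop :=
  ∀ (ν : ℝ), 0 < ν → ∀ (M : ℝ) (T : ℝ), 0 < T → ∀ (u : ℝ → EuclideanSpace ℝ (Fin 3) → EuclideanSpace ℝ (Fin 3))
    (p : ℝ → EuclideanSpace ℝ (Fin 3) → ℝ), IsClassicalNSSolutionOn (Set.Ico 0 T) ν 0 u p →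
    IsLerayHopfOn T ν 0 (u 0) u → HasRapidSpatialDecay (u 0) →
    ∀ (x₀ : EuclideanSpace ℝ (Fin 3)) (ρ : ℝ), 0 < ρ →
    (∀ t ∈ Set.Ico 0 T, T - ρ ^ 2 < t → ∀ x ∈ Metric.ball x₀ ρ, ‖u t x‖ * (‖x - x₀‖ + Real.sqrt (ν * (T - t))) ≤ M) →
    ¬ IsBackwardBoundedAt u T x₀ →
    ∀ (t : ℕ → ℝ), (∀ n, t n < T) → Tendsto t atTop (𝓝 T) →
    ∃ (φ : ℕ → ℕ) (C : ℝ) (v : ℝ → EuclideanSpace ℝ (Fin 3) → EuclideanSpace ℝ (Fin 3)) (lam : ℕ → ℝ),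
      StrictMono φ ∧ (∀ j, 0 < lam j) ∧ (∀ j, lam j ^ 2 = ν * (T - t (φ j))) ∧ IsDoorProfile C v ∧
      IsBackwardSingularPoint v 0 ∧
      ∀ s < 0, ∀ y, Tendsto (fun j => (lam j / ν) • u (T + lam j ^ 2 * s / ν) (x₀ + lam j • y)) atTop (𝓝 (v s y))

/-- **I1b · THE `L³`-FLOOR OF A SINGULAR TYPE-I PROFILE** («ε-regularity in terms of velocity only, under Type I»).  A door-class
profile with the space–time Type-I decay `D/(|x|+√−t)` that is backward-singular at the apex has the scale-invariant `L³`-floor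
`∫_{Q(r)} |v|³ ≥ c r²` at EVERY scale, with `c = c(D) > 0` (CKN ε-regularity at each scale + the Type-I bound on the scaled Riesz
pressure; equivalently: under Type I, `C(r) < ε(D)` at ONE scale ⇒ regular). -/
def SingularProfileFloor : Prop :=
  ∀ (D : ℝ), 0 < D → ∃ c : ℝ, 0 < c ∧ ∀ (C : ℝ) (v : ℝ → EuclideanSpace ℝ (Fin 3) → EuclideanSpace ℝ (Fin 3)),
    IsDoorProfile C v → HasTypeIDecay D v → IsBackwardSingularPoint v 0 → HasL3Floor c v

end Summit.NavierStokesRegularity.NavierStokesRegularity.Theorems.StableStrataDoorOneSliceDefs
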